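import Literature.Computability.QuantumComplexity.QuantumTuringProofs
import Literature.Computability.Cryptography.QuantumTuringMachineWellFormed
import Literature.Computability.Cryptography.QuantumTuringMachinePositionedFaithful
import Literature.Computability.Cryptography.QuantumTuringMachineProofs
import HarnessLib

/-!
# The rotation walk is well formed in both models; `BQPQTMPosWith adhAmplitudes` is inhabited

Addendum to `QuantumTuringProofs.lean` (section `RotationWalk`: the unidirectional two-state
machine with amplitudes `Rθ`, `cos θ = 3/5`, `sin θ = 4/5`, in `adhAmplitudes`, whose acceptance
probability after two steps on the empty input is `576/625` in the tree's head-relative model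
(`RotationWalk.acceptProbAt_nil_two`) and `288/625` in Bernstein–Vazirani's positioned model
(`RotationWalk.pacceptProbAt_nil_two`)). The docstrings there assert that the machine is well
formed; this file PROVES it, in both models, closing the review follow-up of p31847
(`Cryptography/QuantumTuringMachinePositioned.lean`: "exhibit a machine satisfying
`QTM.PIsWellFormed`, so that `BQPQTMPos` is visibly non-empty"):

* `RotationWalk.unit_length`, `RotationWalk.orthogonal` — Bernstein–Vazirani's local conditions
  (SIAM J. Comput. 26 (1997), Thm. 5.3; separability is vacuous for a unidirectional table,
  Def. 3.14) for the columns of `Rθ`: `(3/5)² + (4/5)² = 1`, `(3/5)(-4/5) + (4/5)(3/5) = 0`;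
* `RotationWalk.isWellFormed` — well formed in the tree's model, by
  `QTM.isWellFormed_of_unidirectional` (`Cryptography/QuantumTuringMachineWellFormed.lean`);
* `RotationWalk.pIsWellFormed` — well formed in Bernstein–Vazirani's sense (Def. 3.3), by
  `QTM.IsWellFormed.pIsWellFormed` (`…PositionedFaithful.lean`; `Bool` has the non-blank `true`);
* `zero_mem_BQPQTMPosWith_adhAmplitudes`, `zero_mem_BQPQTMPos` — the positioned classes are
  inhabited by a genuine machine: observed at time `0`, the rotation walk (start state `r`,
  accepting state `ℓ`) decides the empty language `0 : Language Bool`.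

So the model discrepancy recorded for S03–S05 is now an instance of a single machine, well formed
in both senses, with amplitudes in `{0, ±3/5, ±4/5, ±1}`, whose two acceptance functionals differ
(`576/625 ≠ 288/625`). No definition and no named fact is introduced.

## References

* E. Bernstein, U. Vazirani, *Quantum complexity theory*, SIAM J. Comput. 26 (1997) 1411–1473
  [BernsteinVaziraniSICOMP1997]: Def. 3.3 (well formed), Def. 3.14 (unidirectional), Thm. 5.3
  (local well-formedness conditions).
-/

noncomputable section

namespace Literature.Computability.QuantumComplexity

open Cryptography Complexity Turing

namespace RotationWalk

/-- The rotation walk is unidirectional: an amplitude into state `q` vanishes unless the head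
moves in direction `dirOf q` (Bernstein–Vazirani 1997, Def. 3.14). [cite: BernsteinVaziraniSICOMP1997, Def. 3.14] -/
theorem δ_eq_zero_of_ne (p : Bool) (a : Bool) (q : Bool) (b : Bool) (d : Dir) (h : d ≠ dirOf q) :
    machine.δ p a q b d = 0 := by
  show (if b = a ∧ d = dirOf q then rot q p else 0) = 0
  rw [if_neg]
  exact fun hc => h hc.2

/-- The unidirectional transition amplitudes: `δ p a q b (dirOf q) = [b = a] · Rθ[q, p]`. [folklore] -/
theorem δ_dirOf (p a q b : Bool) :
    machine.δ p a q b (dirOf q) = if b = a then rot q p else 0 := by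
  show (if b = a ∧ dirOf q = dirOf q then rot q p else 0) = _
  by_cases h : b = a <;> simp [h]

/-- **Unit length** of the columns of the local matrix (Bernstein–Vazirani 1997, Thm. 5.3,
condition 1): `(3/5)² + (4/5)² = 1`. [cite: BernsteinVaziraniSICOMP1997, Thm. 5.3] -/
theorem unit_length (p a : Bool) :
    ∑ y : Bool × Bool, ‖machine.δ p a y.1 y.2 (dirOf y.1)‖ ^ 2 = 1 := by
  simp only [Fintype.sum_prod_type, Fintype.sum_bool]
  cases p <;> cases a <;> simp [rot] <;> norm_num

/-- **Orthogonality** of distinct columns of the local matrix (Bernstein–Vazirani 1997,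
Thm. 5.3, condition 2): `(3/5)(-4/5) + (4/5)(3/5) = 0`. [cite: BernsteinVaziraniSICOMP1997, Thm. 5.3] -/
theorem orthogonal (p₁ a₁ p₂ a₂ : Bool) (h : (p₁, a₁) ≠ (p₂, a₂)) :
    ∑ y : Bool × Bool,
      (starRingEnd ℂ) (machine.δ p₁ a₁ y.1 y.2 (dirOf y.1)) * machine.δ p₂ a₂ y.1 y.2 (dirOf y.1) = 0 := by
  simp only [Fintype.sum_prod_type, Fintype.sum_bool]
  cases p₁ <;> cases a₁ <;> cases p₂ <;> cases a₂ <;>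
    simp [rot, map_div₀, map_ofNat, map_neg] at h ⊢ <;> norm_num

/-- **The rotation walk is well formed in the tree's model** (`QTM.IsWellFormed`), by
Bernstein–Vazirani's local criterion for unidirectional tables (Thm. 5.3, here
`QTM.isWellFormed_of_unidirectional`). [cite: BernsteinVaziraniSICOMP1997, Thm. 5.3] -/
theorem isWellFormed : machine.IsWellFormed :=
  QTM.isWellFormed_of_unidirectional (M := machine) dirOf δ_eq_zero_of_ne unit_length orthogonal

/-- **The rotation walk is well formed in Bernstein–Vazirani's (positioned) model**
(`QTM.PIsWellFormed`, BV 1997 Def. 3.3): by `QTM.IsWellFormed.pIsWellFormed`, the tape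
alphabet `Bool` having the non-blank symbol `true`. Together with
`RotationWalk.pacceptProbAt_nil_two` (`288/625`) and `RotationWalk.acceptProbAt_nil_two`
(`576/625`) this makes the model discrepancy an instance of ONE well-formed machine with
amplitudes in `adhAmplitudes` observed in the two semantics. [cite: BernsteinVaziraniSICOMP1997, Def. 3.3] -/
theorem pIsWellFormed : machine.PIsWellFormed :=
  QTM.IsWellFormed.pIsWellFormed (M := machine) ⟨true, by decide⟩ isWellFormed

/-- At time `0` the rotation walk is in its start state `r ≠ ℓ`: positioned acceptance
probability `0` on every input. [folklore] -/
theorem pacceptProbAt_zero (x : List Bool) : machine.pacceptProbAt x 0 = 0 := by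
  unfold QTM.pacceptProbAt QTM.pstateAt
  rw [Function.iterate_zero_apply, Finsupp.sum_single_index] <;> rfl

end RotationWalk

/-- **`BQPQTMPosWith adhAmplitudes` is inhabited by a genuine machine**: the empty language is
(`0 : Language Bool`) decided (observation time `p = 0`) by the rotation walk, a Bernstein–Vazirani well-formed QTM with
amplitudes in `{0, ±3/5, ±4/5, ±1}` — a non-vacuity witness for the positioned classes of
`Cryptography/QuantumTuringMachinePositioned.lean` (the review follow-up of p31847). [folklore] -/
theorem zero_mem_BQPQTMPosWith_adhAmplitudes : (0 : Language Bool) ∈ BQPQTMPosWith adhAmplitudes := by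
  refine ⟨RotationWalk.machine, 0, RotationWalk.pIsWellFormed, RotationWalk.amplitudes_subset,
    fun x => ⟨fun hx => ?_, fun _ => ?_⟩⟩
  · exact absurd hx (Language.notMem_zero x)
  · rw [Polynomial.eval_zero, RotationWalk.pacceptProbAt_zero]
    norm_num

/-- Hence also `0 ∈ BQPQTMPos` (monotonicity along
`adhAmplitudes ⊆ polyTimeComputableComplex`). [folklore] -/
theorem zero_mem_BQPQTMPos : (0 : Language Bool) ∈ BQPQTMPos :=
  BQPQTMPosWith_mono adhAmplitudes_subset_polyTimeComputableComplex_holds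
    zero_mem_BQPQTMPosWith_adhAmplitudes

end Literature.Computability.QuantumComplexity
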